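import Mathlib
import HarnessLib
import Literature.NumberTheory.Irrationality.Zudilin2014.FirstTale
import Summits.KontsevichZagierPeriods.Zeta5Search.Denom.TwoTaleP15Forms

/-!
# TwoTaleP15Bridge — the explicit P15 forms `TwoTaleP15Forms.formQ/ratR/polyP/newtonA/formP` ARE Zudilin's
general first-tale objects `Zudilin2014.formQ/R/polyP/coefA/formP` at the parameters P15

HONEST FRAMING: systematic search; no irrationality claim unless certified.

fam-denom (pub-zeta5), FAMILY.md §6 D16, file 23.  `Literature/…/Zudilin2014/FirstTale.lean` (P1 g9, p247260) types
Zudilin's Proposition-1 objects for general integer parameters `a b : Fin 4 → ℤ`; `Denom/TwoTaleP15Forms.lean`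
(fam-denom, file 20) spells them out at P15 `a = (13n+1, 11n+1, 9n+1, 15n+1)`, `b = (1, 2n+1, 4n+1, 26n+2)` with
natural-number binomials.  This file identifies the two, so that arithmetic proved for the general objects transfers
to the `Inclusion`/`Decay`/`CoeffRate` inputs stated for the explicit ones:

* `pA n`, `pB n : Fin 4 → ℤ` — the P15 parameter vectors (bodies literally `fun i => (slopeA i : ℤ) * n + 1`,
  `slopeA = ![13, 11, 9, 15]`, and `![1, 2n+1, 4n+1, 26n+2]`, so that P1 g9's `aP15 n = pA n`, `bP15 n = pB n` hold by
  `rfl`); PROVED `dExp = 16n − 1` (`n ≥ 1`), `amax = 15n + 1`;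
* `prod_Ico_neg_add` — `∏_{lo ≤ i < lo+m} (−k + i) = (−1)^m · m! · C(k − lo, m)` (`lo + m ≤ k`);
* **`coefC_eq`**: `Zudilin2014.coefC (pA n) (pB n) k = TwoTaleP15Forms.coefC n k` for `15n+1 ≤ k ≤ 26n+1`;
* **`formQ_eq`**: `Zudilin2014.formQ (pA n) (pB n) = TwoTaleP15Forms.formQ n` (`n ≥ 1`);
* **`R_eq_ratR`**: `Zudilin2014.R (pA n) (pB n) m = TwoTaleP15Forms.ratR n m` for every integer `m`;
* CONDITIONAL on the polar decomposition `P(m) = R(m) − Σ_k C_k/(m+k)` at the integers `m ≥ −11n` (eq. (P1)–(P2)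
  of [Zu14] evaluated at `t = m`; P1 g9's `FirstTaleScaling.R_eq_polyP_add_polar`, in the gate — taken here as an
  explicit hypothesis) and on `a₂* = 11n+1`: `polyP_eq`, `coefA_eq`, **`formP_eq`**
  (`Zudilin2014.formP (pA n) (pB n) = TwoTaleP15Forms.formP n`).
All statements are identities of explicit finite sums/products; nothing is assumed about `ζ(2)`.
-/

noncomputable section

open Finset Polynomial
open Literature.NumberTheory.Irrationality
open Summit.KontsevichZagierPeriods.Zeta5Search.Denom.TwoTaleP15Forms

namespace Summit.KontsevichZagierPeriods.Zeta5Search.Denom.TwoTaleP15Bridge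

/-! ### Reindexing integer intervals by naturals -/

/-- `Ico (lo : ℤ) hi` for naturals `lo, hi` is the image of `Ico lo hi ⊆ ℕ`. -/
theorem Ico_natCast_eq_map (lo hi : ℕ) : Ico (lo : ℤ) hi = (Ico lo hi).map Nat.castEmbedding := by
  ext z
  simp only [mem_Ico, mem_map, Nat.castEmbedding_apply]
  constructor
  · intro h; exact ⟨z.toNat, by omega, by omega⟩
  · rintro ⟨k, hk, rfl⟩; omega

/-- A signed falling product: `∏_{lo ≤ i < lo+m} (−k + i) = (−1)^m · m! · C(k − lo, m)` for `lo + m ≤ k`. -/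
theorem prod_Ico_neg_add (lo m k : ℕ) (h : lo + m ≤ k) :
    ∏ i ∈ Ico (lo : ℤ) ((lo + m : ℕ) : ℤ), (-(k : ℚ) + (i : ℚ)) =
      (-1) ^ m * (m.factorial : ℚ) * ((k - lo).choose m : ℚ) := by
  rw [Ico_natCast_eq_map, prod_map]
  simp only [Nat.castEmbedding_apply, Int.cast_natCast]
  rw [Finset.prod_Ico_eq_prod_range, Nat.add_sub_cancel_left, mul_assoc, ← Nat.cast_mul,
    ← Nat.descFactorial_eq_factorial_mul_choose, Nat.descFactorial_eq_prod_range, Nat.cast_prod]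
  have : ((-1 : ℚ)) ^ m = ∏ _j ∈ range m, (-1 : ℚ) := by simp
  rw [this, ← prod_mul_distrib]
  refine prod_congr rfl fun j hj => ?_
  rw [mem_range] at hj
  push_cast
  rw [Nat.cast_sub (by omega), Nat.cast_sub (by omega)]
  ring

/-! ### The parameter point P15 -/

/-- The slopes `(13, 11, 9, 15)` of `a` at P15. -/
def slopeA : Fin 4 → ℕ := ![13, 11, 9, 15]

/-- `a = (13n+1, 11n+1, 9n+1, 15n+1)`. -/
def pA (n : ℕ) : Fin 4 → ℤ := fun i => (slopeA i : ℤ) * n + 1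

/-- `b = (1, 2n+1, 4n+1, 26n+2)`. -/
def pB (n : ℕ) : Fin 4 → ℤ := ![1, 2 * (n : ℤ) + 1, 4 * (n : ℤ) + 1, 26 * (n : ℤ) + 2]

variable (n : ℕ)

/-- `a₁ = 13n+1`. -/
@[simp] theorem pA_zero : pA n 0 = 13 * n + 1 := by simp [pA, slopeA]
/-- `a₂ = 11n+1`. -/
@[simp] theorem pA_one : pA n 1 = 11 * n + 1 := by simp [pA, slopeA]
/-- `a₃ = 9n+1`. -/
@[simp] theorem pA_two : pA n 2 = 9 * n + 1 := by simp [pA, slopeA]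
/-- `a₄ = 15n+1`. -/
@[simp] theorem pA_three : pA n 3 = 15 * n + 1 := by simp [pA, slopeA]
/-- `b₁ = 1`. -/
@[simp] theorem pB_zero : pB n 0 = 1 := by simp [pB]
/-- `b₂ = 2n+1`. -/
@[simp] theorem pB_one : pB n 1 = 2 * n + 1 := by simp [pB]
/-- `b₃ = 4n+1`. -/
@[simp] theorem pB_two : pB n 2 = 4 * n + 1 := by simp [pB]
/-- `b₄ = 26n+2`. -/
@[simp] theorem pB_three : pB n 3 = 26 * n + 2 := by simp [pB]

variable {n}

/-- `d = Σ a − Σ b = 16n − 1` at P15 (`n ≥ 1`). -/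
theorem dExp_P15 (hn : 1 ≤ n) : Zudilin2014.dExp (pA n) (pB n) = 16 * n - 1 := by
  unfold Zudilin2014.dExp
  simp only [Fin.sum_univ_four, pA_zero, pA_one, pA_two, pA_three, pB_zero, pB_one, pB_two, pB_three]
  omega

/-- `a₄* = max a = 15n + 1` at P15. -/
theorem amax_P15 (n : ℕ) : Zudilin2014.amax (pA n) = 15 * n + 1 := by
  unfold Zudilin2014.amax
  rw [pA_zero, pA_one, pA_two, pA_three]
  simp only [max_def]
  split_ifs <;> omega

/-- The factorial normalisation `numFac = (13n)! (9n)! (5n)!` at P15. -/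
theorem numFac_P15 (n : ℕ) :
    Zudilin2014.numFac (pA n) (pB n) =
      ((13 * n).factorial : ℚ) * ((9 * n).factorial : ℚ) * ((5 * n).factorial : ℚ) := by
  unfold Zudilin2014.numFac Zudilin2014.facZ
  rw [pA_zero, pA_one, pA_two, pB_zero, pB_one, pB_two]
  have t0 : ((13 * (n : ℤ) + 1) - 1).toNat = 13 * n := by omega
  have t1 : ((11 * (n : ℤ) + 1) - (2 * n + 1)).toNat = 9 * n := by omega
  have t2 : ((9 * (n : ℤ) + 1) - (4 * n + 1)).toNat = 5 * n := by omega
  rw [t0, t1, t2]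

/-- `R₁(−k) = (−1)^{13n} C(k−1,13n) · (−1)^{9n} C(k−2n−1,9n) · (−1)^{5n} C(k−4n−1,5n)` for `k ≥ 15n+1`. -/
theorem eval_R1_neg {k : ℕ} (hk : 15 * n + 1 ≤ k) :
    (Zudilin2014.R1 (pA n) (pB n)).eval (-(k : ℚ)) =
      (-1) ^ (13 * n) * ((k - 1).choose (13 * n) : ℚ) *
        ((-1) ^ (9 * n) * ((k - (2 * n + 1)).choose (9 * n) : ℚ)) *
        ((-1) ^ (5 * n) * ((k - (4 * n + 1)).choose (5 * n) : ℚ)) := by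
  unfold Zudilin2014.R1 Zudilin2014.num
  rw [eval_mul, eval_C, eval_mul, eval_mul, Zudilin2014.eval_block, Zudilin2014.eval_block,
    Zudilin2014.eval_block, numFac_P15, pA_zero, pA_one, pA_two, pB_zero, pB_one, pB_two]
  have e0 : Ico (1 : ℤ) (13 * (n : ℤ) + 1) = Ico ((1 : ℕ) : ℤ) ((1 + 13 * n : ℕ) : ℤ) := by
    congr 1; push_cast; ring
  have e1 : Ico (2 * (n : ℤ) + 1) (11 * (n : ℤ) + 1) =
      Ico ((2 * n + 1 : ℕ) : ℤ) ((2 * n + 1 + 9 * n : ℕ) : ℤ) := by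
    congr 1; push_cast; ring
  have e2 : Ico (4 * (n : ℤ) + 1) (9 * (n : ℤ) + 1) =
      Ico ((4 * n + 1 : ℕ) : ℤ) ((4 * n + 1 + 5 * n : ℕ) : ℤ) := by
    congr 1; push_cast; ring
  rw [e0, e1, e2, prod_Ico_neg_add 1 (13 * n) k (by omega), prod_Ico_neg_add (2 * n + 1) (9 * n) k (by omega),
    prod_Ico_neg_add (4 * n + 1) (5 * n) k (by omega)]
  have hF : ((13 * n).factorial : ℚ) * ((9 * n).factorial : ℚ) * ((5 * n).factorial : ℚ) ≠ 0 := by positivity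
  rw [inv_mul_eq_iff_eq_mul₀ hF]
  ring

/-- **`C_k` agree**: `Zudilin2014.coefC (pA n) (pB n) k = TwoTaleP15Forms.coefC n k` for `15n+1 ≤ k ≤ 26n+1`. -/
theorem coefC_eq {k : ℕ} (hk : 15 * n + 1 ≤ k) (hk' : k ≤ 26 * n + 1) :
    Zudilin2014.coefC (pA n) (pB n) k = (coefC n k : ℚ) := by
  unfold Zudilin2014.coefC Zudilin2014.eps
  rw [Int.cast_natCast, eval_R1_neg hk, pA_three, pB_three]
  have t3 : ((k : ℤ) - (15 * (n : ℤ) + 1)).toNat = k - (15 * n + 1) := by omega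
  have t4 : ((26 * (n : ℤ) + 2) - (15 * (n : ℤ) + 1) - 1).toNat = 11 * n := by omega
  rw [t3, t4, coefC]
  push_cast
  rw [Nat.choose_symm_of_eq_add (show k - 1 = (k - (13 * n + 1)) + 13 * n by omega),
    Nat.choose_symm_of_eq_add (show k - (2 * n + 1) = (k - (11 * n + 1)) + 9 * n by omega),
    Nat.choose_symm_of_eq_add (show k - (4 * n + 1) = (k - (9 * n + 1)) + 5 * n by omega)]
  have hs : (-1 : ℚ) ^ (k - (15 * n + 1)) * (-1) ^ (13 * n) * (-1) ^ (9 * n) * (-1) ^ (5 * n) =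
      (-1) ^ (k + 1) := by
    rw [← pow_add, ← pow_add, ← pow_add, neg_one_pow_eq_pow_mod_two,
      show (k - (15 * n + 1) + 13 * n + 9 * n + 5 * n) % 2 = (k + 1) % 2 by omega, ← neg_one_pow_eq_pow_mod_two]
  linear_combination (((k - 1).choose (13 * n) : ℚ) * ((k - (2 * n + 1)).choose (9 * n) : ℚ) *
    ((k - (4 * n + 1)).choose (5 * n) : ℚ) * ((11 * n).choose (k - (15 * n + 1)) : ℚ)) * hs

/-- The summation range `[a₄*, b₄) = [15n+1, 26n+2)` as an image of naturals. -/
theorem Ico_range_eq (n : ℕ) :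
    Ico (Zudilin2014.amax (pA n)) (pB n 3) = (Ico (15 * n + 1) (26 * n + 2)).map Nat.castEmbedding := by
  rw [amax_P15, pB_three, ← Ico_natCast_eq_map]; push_cast; rfl

/-- **`q` agrees**: `Zudilin2014.formQ (pA n) (pB n) = TwoTaleP15Forms.formQ n` (`n ≥ 1`). -/
theorem formQ_eq (hn : 1 ≤ n) : Zudilin2014.formQ (pA n) (pB n) = (formQ n : ℚ) := by
  unfold Zudilin2014.formQ
  rw [dExp_P15 hn, Odd.neg_one_pow ⟨8 * n - 1, by omega⟩, Ico_range_eq, sum_map, formQ]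
  push_cast
  rw [neg_one_mul]
  congr 1
  refine sum_congr rfl fun k hk => ?_
  rw [mem_Ico] at hk
  rw [Nat.castEmbedding_apply, coefC_eq hk.1 (by omega)]

/-- **`R` agrees** at every integer: `Zudilin2014.R (pA n) (pB n) m = TwoTaleP15Forms.ratR n m`. -/
theorem R_eq_ratR (n : ℕ) (m : ℤ) : Zudilin2014.R (pA n) (pB n) m = ratR n m := by
  unfold Zudilin2014.R Zudilin2014.Pi Zudilin2014.num Zudilin2014.den
  rw [numFac_P15, eval_mul, eval_mul, Zudilin2014.eval_block, Zudilin2014.eval_block, Zudilin2014.eval_block,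
    Zudilin2014.eval_block, Zudilin2014.facZ, pA_zero, pA_one, pA_two, pA_three, pB_zero, pB_one, pB_two,
    pB_three]
  have t : ((26 * (n : ℤ) + 2) - (15 * (n : ℤ) + 1) - 1).toNat = 11 * n := by omega
  have e0 : Ico (1 : ℤ) (13 * (n : ℤ) + 1) = Ico ((1 : ℕ) : ℤ) ((13 * n + 1 : ℕ) : ℤ) := by push_cast; rfl
  have e1 : Ico (2 * (n : ℤ) + 1) (11 * (n : ℤ) + 1) = Ico ((2 * n + 1 : ℕ) : ℤ) ((11 * n + 1 : ℕ) : ℤ) := by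
    push_cast; rfl
  have e2 : Ico (4 * (n : ℤ) + 1) (9 * (n : ℤ) + 1) = Ico ((4 * n + 1 : ℕ) : ℤ) ((9 * n + 1 : ℕ) : ℤ) := by
    push_cast; rfl
  have e3 : Ico (15 * (n : ℤ) + 1) (26 * (n : ℤ) + 2) = Ico ((15 * n + 1 : ℕ) : ℤ) ((26 * n + 2 : ℕ) : ℤ) := by
    push_cast; rfl
  rw [t, e0, e1, e2, e3, Ico_natCast_eq_map, Ico_natCast_eq_map, Ico_natCast_eq_map, Ico_natCast_eq_map,
    prod_map, prod_map, prod_map, prod_map, ratR]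
  simp only [Nat.castEmbedding_apply, Int.cast_natCast]
  ring

/-! ### The `p`-side, conditional on the polar decomposition of `R` at integers

The hypothesis `hP` below is eq. (P1)–(P2) of [Zu14] evaluated at the integers `m ≥ −11n` (no pole there):
`P(m) = R(m) − Σ_{k ∈ [a₄, b₄)} C_k/(m+k)` — a theorem of `FirstTaleScaling` (P1 g9) for the general objects. -/

/-- **`P` agrees** at the integers `m ≥ −11n`, given the polar decomposition. -/
theorem polyP_eq
    (hP : ∀ m : ℤ, -(11 * (n : ℤ)) ≤ m → (Zudilin2014.polyP (pA n) (pB n)).eval (m : ℚ) =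
      Zudilin2014.R (pA n) (pB n) m - ∑ k ∈ Ico (pA n 3) (pB n 3), Zudilin2014.coefC (pA n) (pB n) k / ((m : ℚ) + k))
    {m : ℤ} (hm : -(11 * (n : ℤ)) ≤ m) :
    (Zudilin2014.polyP (pA n) (pB n)).eval (m : ℚ) = polyP n m := by
  rw [hP m hm, polyP, R_eq_ratR, pA_three, ← amax_P15, Ico_range_eq, sum_map]
  congr 1
  refine sum_congr rfl fun k hk => ?_
  rw [mem_Ico] at hk
  rw [Nat.castEmbedding_apply, coefC_eq hk.1 (by omega), Int.cast_natCast]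

/-- `H₂(m) = Σ_{l<m} (l+1)⁻² = Σ_{l=1}^{m} l⁻²`. -/
theorem harmTwo_eq (m : ℕ) : Zudilin2014.harmTwo m = ∑ l ∈ Icc 1 m, 1 / ((l : ℚ) ^ 2) := by
  unfold Zudilin2014.harmTwo
  induction m with
  | zero => simp
  | succ m ih =>
    rw [sum_range_succ, ih, sum_Icc_succ_top (by omega)]
    push_cast
    ring

/-- **`A_ℓ` agree**, given the polar decomposition and `a₂* = 11n+1`. -/
theorem coefA_eq
    (hP : ∀ m : ℤ, -(11 * (n : ℤ)) ≤ m → (Zudilin2014.polyP (pA n) (pB n)).eval (m : ℚ) =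
      Zudilin2014.R (pA n) (pB n) m - ∑ k ∈ Ico (pA n 3) (pB n 3), Zudilin2014.coefC (pA n) (pB n) k / ((m : ℚ) + k))
    (h2 : Zudilin2014.a2star (pA n) = 11 * n + 1) (ℓ : ℕ) :
    Zudilin2014.coefA (pA n) (pB n) ℓ = newtonA n ℓ := by
  unfold Zudilin2014.coefA newtonA
  refine sum_congr rfl fun i _ => ?_
  rw [h2]
  have : (1 : ℚ) + i - ((11 * (n : ℤ) + 1 : ℤ) : ℚ) = (((i : ℤ) - 11 * n : ℤ) : ℚ) := by push_cast; ring
  rw [this, polyP_eq hP (by omega)]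

/-- **`p` agrees**: `Zudilin2014.formP (pA n) (pB n) = TwoTaleP15Forms.formP n` (`n ≥ 1`), given the polar
decomposition and `a₂* = 11n+1`. -/
theorem formP_eq (hn : 1 ≤ n)
    (hP : ∀ m : ℤ, -(11 * (n : ℤ)) ≤ m → (Zudilin2014.polyP (pA n) (pB n)).eval (m : ℚ) =
      Zudilin2014.R (pA n) (pB n) m - ∑ k ∈ Ico (pA n 3) (pB n 3), Zudilin2014.coefC (pA n) (pB n) k / ((m : ℚ) + k))
    (h2 : Zudilin2014.a2star (pA n) = 11 * n + 1) : Zudilin2014.formP (pA n) (pB n) = formP n := by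
  unfold Zudilin2014.formP
  rw [dExp_P15 hn, Odd.neg_one_pow ⟨8 * n - 1, by omega⟩, Ico_range_eq, sum_map, formP, h2,
    show 16 * n - 1 + 1 = 16 * n by omega, neg_one_mul]
  congr 1
  congr 1
  · refine sum_congr rfl fun k hk => ?_
    rw [mem_Ico] at hk
    have t : (((k : ℕ) : ℤ) - (11 * (n : ℤ) + 1)).toNat = k - (11 * n + 1) := by omega
    rw [Nat.castEmbedding_apply, coefC_eq hk.1 (by omega), t, harmTwo_eq]
  · refine sum_congr rfl fun l _ => ?_
    rw [coefA_eq hP h2]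

end Summit.KontsevichZagierPeriods.Zeta5Search.Denom.TwoTaleP15Bridge
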